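import Mathlib
import HarnessLib
import Literature.MathematicalPhysics.KineticTheory.HardSphereEulerProofs
import Summits.AtomisticToContinuum.HydrodynamicLimit.Theorems.OneFlightGossipEngineKineticCurrentsWindowLDApriori
import Summits.AtomisticToContinuum.HydrodynamicLimit.Theorems.OneFlightGossipEngineKineticCurrentsWindowLDUniformFibreExpMoment
import Summits.AtomisticToContinuum.HydrodynamicLimit.Theorems.OneFlightGossipEngineKineticCurrentsWindowLDUniformStaticFreezingStatics

/-!
# Static freezing: the Rényi cost of freezing the local Gibbs profiles along a small
# displacement (stub `stub_staticFreezing` of line `sigma-uniform-equilibrium-transfer` for the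
# crux `KineticCurrentsWindowLDUniform`, stmt-AtomisticToContinuum-14662)

For continuous profiles `a, θ₀ > 0`, `u₀` on `𝕋³`, reduced density `0 < σ ≤ 1/2`, a Rényi
order `p > 1` and a budget `δ > 0` there is `ρ₀ > 0` such that for EVERY measurable self-map
`π` of `𝕋³` with `dist(π x, x) ≤ ρ₀` and every `N`,
`∫ ψ^p ψ_π^{1-p} dL ≤ exp(p δ (N+1))`, where `ψ`, `ψ_π` are the canonical densities of `N + 1`
hard spheres with the local Gibbs profiles `(a, u₀, θ₀)` and the FROZEN profiles
`(a∘π, u₀∘π, θ₀∘π)`, and `L` is the Liouville measure. No dynamics is involved.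

Proof. On the hard-sphere domain `ψ = Z⁻¹ ∏ᵢ f(zᵢ)`, `ψ_π = Z_π⁻¹ ∏ᵢ f_π(zᵢ)` with
`f(x,v) = a(x) M_{1,u₀(x),θ₀(x)}(v)`, so
`ψ^p ψ_π^{1-p} = ψ · exp((p−1)[(log Z_π − log Z) + Σᵢ (log f(zᵢ) − log f_π(zᵢ))])`.
If the data `(log a, log θ₀, u₀, θ₀⁻¹)` move by at most `e` under `π` (uniform continuity on
the compact torus, `ρ₀ = ρ₀(e)`), then per particle
`log f − log f_π ≤ e(5/2 + θₘ⁻¹) + e(1 + θₘ⁻¹)/2 · ‖v − u₀(x)‖²` (`StaticFreezing.log_ratio_le`)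
and `Z_π ≤ e^{e(N+1)} Z` (`StaticFreezing.canonicalPartition_le_pow_mul`: the Maxwellians of
the frozen, merely measurable, profile still integrate to one; this also gives `Z_π > 0`, so
`ψ_π > 0` on the domain and the `ℝ≥0∞` powers are genuine). Hence
`∫ ψ^p ψ_π^{1-p} dL ≤ C₁^{N+1} ∫ ∏ᵢ exp(s‖vᵢ − u₀(xᵢ)‖²) dλ` with `λ = ψ dz` the local Gibbs
measure, `C₁ = exp((p−1) e (7/2 + θₘ⁻¹))`, `s = (p−1) e (1+θₘ⁻¹)/2`; the fibrewise Gaussian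
moment (`stub_fibreExpMoment`, `∫ e^{s‖v−u‖²} dN(u,θ) = (1−2sθ)^{-3/2}`) bounds the last
integral by `(1 − 2sΘ)^{-3(N+1)/2}`, `Θ = max θ₀`, and `e = e(p, δ, θₘ, Θ)` is chosen so that
`C₁ (1−2sΘ)^{-3/2} ≤ e^{pδ}` (`StaticFreezing.exists_tolerance`).

References: H. Spohn, *Large Scale Dynamics of Interacting Particles* (1991), Part I §2.3.
-/

noncomputable section

open MeasureTheory Set Filter
open scoped ENNReal Topology

namespace Summit.AtomisticToContinuum.HydrodynamicLimit.Theorems.KineticCurrentsWindowLDUniformSigmaUniform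

open Literature.Analysis.FluidPDE (HardSphereFlow Config localMaxwellian canonicalDensity liouville)
open Literature.MathematicalPhysics.KineticTheory (T3 V3 hsDiameter localGibbsLaw localGibbsMeasure
  localGibbsProfile)
open Literature.Analysis.FluidPDE Literature.MathematicalPhysics.KineticTheory

/-- **Static freezing (Rényi cost of freezing the profiles along a small displacement).**
For continuous positive profiles, `0 < σ ≤ 1/2`, an order `p > 1` and `δ > 0` there is `ρ₀ > 0`
such that for every measurable self-map `π` of `𝕋³` moving points by at most `ρ₀` and every
`N`, the order-`p` Rényi integral of the local Gibbs density `ψ` against the density `ψ_π` with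
frozen profiles `(a∘π, u₀∘π, θ₀∘π)` is at most `exp(p δ (N+1))`:
`∫ ψ^p ψ_π^{1-p} dL ≤ e^{pδ(N+1)}`. Registered stub `stub_staticFreezing` of line
`sigma-uniform-equilibrium-transfer` (crux stmt-AtomisticToContinuum-14662). -/
theorem stub_staticFreezing :
    ∀ (a θ₀ : T3 → ℝ) (u₀ : T3 → V3), Continuous a → Continuous θ₀ → Continuous u₀ →
    (∀ x, 0 < a x) → (∀ x, 0 < θ₀ x) → ∀ σ : ℝ, 0 < σ → σ ≤ 1 / 2 →
    ∀ p : ℝ, 1 < p → ∀ δ : ℝ, 0 < δ → ∃ ρ₀ : ℝ, 0 < ρ₀ ∧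
    ∀ π : T3 → T3, Measurable π → (∀ x, dist (π x) x ≤ ρ₀) → ∀ N : ℕ,
      ∫⁻ z, ENNReal.ofReal (canonicalDensity (Literature.Analysis.FluidPDE.Torus.geometry (Fin 3))
            (hsDiameter σ N) (N + 1) (localGibbsProfile a u₀ θ₀) z) ^ p *
          ENNReal.ofReal (canonicalDensity (Literature.Analysis.FluidPDE.Torus.geometry (Fin 3))
            (hsDiameter σ N) (N + 1) (localGibbsProfile (a ∘ π) (u₀ ∘ π) (θ₀ ∘ π)) z) ^ (1 - p)
        ∂(liouville (Literature.Analysis.FluidPDE.Torus.geometry (Fin 3)) (N + 1) (hsDiameter σ N)) ≤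
      ENNReal.ofReal (Real.exp (p * (δ * ((N : ℝ) + 1)))) := by
  intro a θ₀ u₀ ha hθ hu ha0 hθ0 σ hσ hσ2 p hp δ hδ
  have hp1 : 0 < p - 1 := sub_pos.2 hp
  -- bounds of the profiles on the compact torus
  obtain ⟨θm, hθm0, hθm⟩ : ∃ θm : ℝ, 0 < θm ∧ ∀ x, θm ≤ θ₀ x := by
    obtain ⟨x₀, -, hx₀⟩ := isCompact_univ.exists_isMinOn univ_nonempty hθ.continuousOn
    exact ⟨θ₀ x₀, hθ0 x₀, fun x => (isMinOn_iff.1 hx₀) x (mem_univ x)⟩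
  obtain ⟨Θ, hΘ0, hΘ⟩ : ∃ Θ : ℝ, 0 < Θ ∧ ∀ x, θ₀ x ≤ Θ := by
    obtain ⟨C, -, hC⟩ := exists_forall_abs_le_of_continuous hθ
    exact ⟨max C 1, by positivity, fun x => (le_abs_self _).trans ((hC x).trans (le_max_left _ _))⟩
  obtain ⟨Am, -, hAm⟩ := exists_forall_abs_le_of_continuous ha
  have hAm' : ∀ x, a x ≤ Am := fun x => (le_abs_self _).trans (hAm x)
  -- the tolerance `e` and the displacement `ρ₀`
  obtain ⟨e, he0, he1, hBe, hKe⟩ := StaticFreezing.exists_tolerance hp hδ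
    (A := 7 / 2 + θm⁻¹) (B := (1 + θm⁻¹) * Θ) (by positivity) (by positivity)
  obtain ⟨ρ₁, hρ₁, h₁⟩ := StaticFreezing.exists_dist_le_forall_dist_lt
    (ha.log fun x => (ha0 x).ne') he0
  obtain ⟨ρ₂, hρ₂, h₂⟩ := StaticFreezing.exists_dist_le_forall_dist_lt
    (hθ.log fun x => (hθ0 x).ne') he0
  obtain ⟨ρ₃, hρ₃, h₃⟩ := StaticFreezing.exists_dist_le_forall_dist_lt hu he0
  obtain ⟨ρ₄, hρ₄, h₄⟩ := StaticFreezing.exists_dist_le_forall_dist_lt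
    (hθ.inv₀ fun x => (hθ0 x).ne') he0
  refine ⟨min (min ρ₁ ρ₂) (min ρ₃ ρ₄), by positivity, fun π hπm hπ N => ?_⟩
  -- what the displacement bound gives, pointwise
  have hla : ∀ x, |Real.log (a (π x)) - Real.log (a x)| < e := fun x => by
    rw [← Real.dist_eq]
    exact h₁ _ _ ((hπ x).trans ((min_le_left _ _).trans (min_le_left _ _)))
  have hlθ : ∀ x, |Real.log (θ₀ (π x)) - Real.log (θ₀ x)| < e := fun x => by
    rw [← Real.dist_eq]
    exact h₂ _ _ ((hπ x).trans ((min_le_left _ _).trans (min_le_right _ _)))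
  have hlu : ∀ x, ‖u₀ x - u₀ (π x)‖ < e := fun x => by
    rw [← dist_eq_norm, dist_comm]
    exact h₃ _ _ ((hπ x).trans ((min_le_right _ _).trans (min_le_left _ _)))
  have hlι : ∀ x, |(θ₀ (π x))⁻¹ - (θ₀ x)⁻¹| < e := fun x => by
    rw [← Real.dist_eq]
    exact h₄ _ _ ((hπ x).trans ((min_le_right _ _).trans (min_le_right _ _)))
  have haπ_le : ∀ y, (a ∘ π) y ≤ Real.exp e * a y := fun y => by
    have h := (abs_lt.1 (hla y)).2
    calc (a ∘ π) y = Real.exp (Real.log (a (π y))) := (Real.exp_log (ha0 _)).symm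
      _ ≤ Real.exp (e + Real.log (a y)) := Real.exp_le_exp.2 (by linarith)
      _ = Real.exp e * a y := by rw [Real.exp_add, Real.exp_log (ha0 _)]
  have ha_le : ∀ y, a y ≤ Real.exp e * (a ∘ π) y := fun y => by
    have h := (abs_lt.1 (hla y)).1
    calc a y = Real.exp (Real.log (a y)) := (Real.exp_log (ha0 _)).symm
      _ ≤ Real.exp (e + Real.log (a (π y))) := Real.exp_le_exp.2 (by linarith)
      _ = Real.exp e * (a ∘ π) y := by rw [Real.exp_add, Real.exp_log (ha0 _)]; rfl
  -- the constants
  obtain ⟨s, hs⟩ : ∃ s : ℝ, s = (p - 1) * (e * (1 + θm⁻¹) / 2) := ⟨_, rfl⟩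
  have hs0 : 0 ≤ s := by rw [hs]; positivity
  have hsΘ : 2 * s * Θ < 1 := by rw [hs]; nlinarith
  obtain ⟨C₁, hC₁⟩ : ∃ C₁ : ℝ, C₁ = Real.exp ((p - 1) * (e + e * (5 / 2 + θm⁻¹))) := ⟨_, rfl⟩
  have hC₁0 : 0 < C₁ := by rw [hC₁]; exact Real.exp_pos _
  obtain ⟨K, hK⟩ : ∃ K : ℝ, K = (1 - 2 * s * Θ) ^ (-(3 : ℝ) / 2) := ⟨_, rfl⟩
  have hK0 : 0 ≤ K := by rw [hK]; exact Real.rpow_nonneg (by linarith) _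
  have hCK : C₁ * K ≤ Real.exp (p * δ) := by
    have h1 : C₁ = Real.exp ((p - 1) * (7 / 2 + θm⁻¹) * e) := by rw [hC₁]; congr 1; ring
    have h2 : K = (1 - (p - 1) * ((1 + θm⁻¹) * Θ) * e) ^ (-(3 : ℝ) / 2) := by
      rw [hK, hs]; congr 1; ring
    rw [h1, h2]
    exact hKe
  -- abbreviations
  set ε := hsDiameter σ N with hε
  set f := localGibbsProfile a u₀ θ₀ with hf
  set g := localGibbsProfile (a ∘ π) (u₀ ∘ π) (θ₀ ∘ π) with hg
  set Z := canonicalPartition (Torus.geometry (Fin 3)) ε (N + 1) f with hZ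
  set Zπ := canonicalPartition (Torus.geometry (Fin 3)) ε (N + 1) g with hZπ
  -- the partition functions: positive and comparable
  have hπa : Measurable (a ∘ π) := ha.measurable.comp hπm
  have hπθ : Measurable (θ₀ ∘ π) := hθ.measurable.comp hπm
  have hπu : Measurable (u₀ ∘ π) := hu.measurable.comp hπm
  have hZpos : 0 < Z := by
    rw [hZ, hf, canonicalPartition_eq_posPartition ha hθ hu (fun x => (ha0 x).le) hθ0]
    exact posPartition_pos ha ha0 hσ2 N
  have hZπ_le : Zπ ≤ Real.exp e ^ (N + 1) * Z :=
    StaticFreezing.canonicalPartition_le_pow_mul hπa hπθ hπu ha.measurable hθ.measurable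
      hu.measurable (fun x => (ha0 _).le) (fun x => (ha0 x).le) hAm' (fun x => hθ0 _) hθ0
      (Real.exp_pos e).le haπ_le ε (N + 1)
  have hZ_le : Z ≤ Real.exp e ^ (N + 1) * Zπ :=
    StaticFreezing.canonicalPartition_le_pow_mul ha.measurable hθ.measurable hu.measurable
      hπa hπθ hπu (fun x => (ha0 x).le) (fun x => (ha0 _).le) (fun x => hAm' _) hθ0
      (fun x => hθ0 _) (Real.exp_pos e).le ha_le ε (N + 1)
  have hZπpos : 0 < Zπ := by
    by_contra h
    have h' : Real.exp e ^ (N + 1) * Zπ ≤ 0 :=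
      mul_nonpos_of_nonneg_of_nonpos (pow_nonneg (Real.exp_pos e).le _) (not_lt.1 h)
    linarith
  have hlogZ : Real.log Zπ - Real.log Z ≤ (N + 1 : ℕ) * e := by
    have h := Real.log_le_log hZπpos hZπ_le
    rw [Real.log_mul (pow_pos (Real.exp_pos e) _).ne' hZpos.ne', Real.log_pow, Real.log_exp] at h
    linarith
  -- the fibre factor
  have hum : Measurable u₀ := hu.measurable
  obtain ⟨G, hGdef⟩ : ∃ G : T3 × V3 → ℝ≥0∞,
      G = fun y => ENNReal.ofReal (Real.exp (s * ‖y.2 - u₀ y.1‖ ^ 2)) := ⟨_, rfl⟩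
  have hGm : Measurable G := by rw [hGdef]; fun_prop
  have hGpm : Measurable fun z : Config (N + 1) (Fin 3) T3 => ∏ i, G (z i) :=
    Finset.measurable_prod _ fun i _ => hGm.comp (measurable_pi_apply i)
  have hfib : ∀ x : T3, ∫⁻ v, G (x, v) * ENNReal.ofReal (localMaxwellian 1 (θ₀ x) (u₀ x) v) ≤
      ENNReal.ofReal K := fun x => by
    rw [hGdef, hK]
    exact StaticFreezing.lintegral_exp_mul_localMaxwellian_le (hθ0 x) (hΘ x) hs0 hsΘ (u₀ x)
  have hψm : Measurable fun z => ENNReal.ofReal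
      (canonicalDensity (Torus.geometry (Fin 3)) ε (N + 1) f z) :=
    (measurable_canonicalDensity ε (N + 1) (measurable_localGibbsProfile ha hθ hu)).ennreal_ofReal
  have hDm : MeasurableSet (hardSphereDomain (Torus.geometry (Fin 3)) (N + 1) ε) :=
    measurableSet_hardSphereDomain _ Torus.measurable_geometry_sepVec (N + 1) ε
  -- the pointwise bound on the hard-sphere domain
  have hpt : ∀ z ∈ hardSphereDomain (Torus.geometry (Fin 3)) (N + 1) ε,
      ENNReal.ofReal (canonicalDensity (Torus.geometry (Fin 3)) ε (N + 1) f z) ^ p *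
        ENNReal.ofReal (canonicalDensity (Torus.geometry (Fin 3)) ε (N + 1) g z) ^ (1 - p) ≤
      ENNReal.ofReal (C₁ ^ (N + 1)) *
        (ENNReal.ofReal (canonicalDensity (Torus.geometry (Fin 3)) ε (N + 1) f z) *
          ∏ i, G (z i)) := by
    intro z hz
    have hfpos : ∀ i, 0 < f (z i) := fun i =>
      mul_pos (ha0 _) (localMaxwellian_pos one_pos (hθ0 _) _ _)
    have hgpos : ∀ i, 0 < g (z i) := fun i =>
      mul_pos (ha0 _) (localMaxwellian_pos one_pos (hθ0 _) _ _)
    have hFpos : 0 < ∏ i, f (z i) := Finset.prod_pos fun i _ => hfpos i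
    have hGpos : 0 < ∏ i, g (z i) := Finset.prod_pos fun i _ => hgpos i
    have hψ : canonicalDensity (Torus.geometry (Fin 3)) ε (N + 1) f z = Z⁻¹ * ∏ i, f (z i) := by
      rw [canonicalDensity, indicator_of_mem hz]
      rfl
    have hψπ : canonicalDensity (Torus.geometry (Fin 3)) ε (N + 1) g z = Zπ⁻¹ * ∏ i, g (z i) := by
      rw [canonicalDensity, indicator_of_mem hz]
      rfl
    have hψpos : 0 < Z⁻¹ * ∏ i, f (z i) := mul_pos (inv_pos.2 hZpos) hFpos
    have hψπpos : 0 < Zπ⁻¹ * ∏ i, g (z i) := mul_pos (inv_pos.2 hZπpos) hGpos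
    have hGz : ∏ i, G (z i) = ENNReal.ofReal (∏ i, Real.exp (s * ‖(z i).2 - u₀ (z i).1‖ ^ 2)) := by
      rw [hGdef, ENNReal.ofReal_prod_of_nonneg fun i _ => Real.exp_nonneg _]
    rw [hψ, hψπ, hGz, ENNReal.ofReal_rpow_of_pos hψpos, ENNReal.ofReal_rpow_of_pos hψπpos,
      ← ENNReal.ofReal_mul (Real.rpow_nonneg hψpos.le _),
      ← ENNReal.ofReal_mul hψpos.le, ← ENNReal.ofReal_mul (pow_nonneg hC₁0.le _)]
    refine ENNReal.ofReal_le_ofReal ?_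
    -- everything is an exponential
    rw [Real.rpow_def_of_pos hψpos, Real.rpow_def_of_pos hψπpos, ← Real.exp_add]
    have hLψ : Real.log (Z⁻¹ * ∏ i, f (z i)) = -Real.log Z + ∑ i, Real.log (f (z i)) := by
      rw [Real.log_mul (inv_pos.2 hZpos).ne' hFpos.ne', Real.log_inv,
        Real.log_prod fun i _ => (hfpos i).ne']
    have hLψπ : Real.log (Zπ⁻¹ * ∏ i, g (z i)) = -Real.log Zπ + ∑ i, Real.log (g (z i)) := by
      rw [Real.log_mul (inv_pos.2 hZπpos).ne' hGpos.ne', Real.log_inv,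
        Real.log_prod fun i _ => (hgpos i).ne']
    have hrhs : C₁ ^ (N + 1) * ((Z⁻¹ * ∏ i, f (z i)) *
        ∏ i, Real.exp (s * ‖(z i).2 - u₀ (z i).1‖ ^ 2)) =
        Real.exp ((N + 1 : ℕ) * ((p - 1) * (e + e * (5 / 2 + θm⁻¹))) +
          (Real.log (Z⁻¹ * ∏ i, f (z i)) + ∑ i, s * ‖(z i).2 - u₀ (z i).1‖ ^ 2)) := by
      rw [Real.exp_add, Real.exp_add, Real.exp_nat_mul, ← hC₁, Real.exp_log hψpos, Real.exp_sum]
    rw [hrhs]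
    refine Real.exp_le_exp.2 ?_
    -- per-particle log-ratio bounds
    have hpp : ∀ i, Real.log (f (z i)) - Real.log (g (z i)) ≤
        e * (5 / 2 + θm⁻¹) + e * (1 + θm⁻¹) / 2 * ‖(z i).2 - u₀ (z i).1‖ ^ 2 := fun i =>
      StaticFreezing.log_ratio_le (ha0 _) (ha0 _) (hθ0 _) (hθ0 _) hθm0 (hθm _) he0.le he1
        (by linarith [(abs_lt.1 (hla (z i).1)).1]) (abs_lt.1 (hlθ (z i).1)).2.le
        (hlu (z i).1).le (abs_lt.1 (hlι (z i).1)).2.le (z i).2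
    have hsum : ∑ i, (Real.log (f (z i)) - Real.log (g (z i))) ≤
        ∑ i, (e * (5 / 2 + θm⁻¹) + e * (1 + θm⁻¹) / 2 * ‖(z i).2 - u₀ (z i).1‖ ^ 2) :=
      Finset.sum_le_sum fun i _ => hpp i
    rw [Finset.sum_sub_distrib, Finset.sum_add_distrib, Finset.sum_const, Finset.card_univ,
      Fintype.card_fin, nsmul_eq_mul, ← Finset.mul_sum] at hsum
    have hQ0 : 0 ≤ ∑ i, ‖(z i).2 - u₀ (z i).1‖ ^ 2 := Finset.sum_nonneg fun i _ => sq_nonneg _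
    have hkey : Real.log (Z⁻¹ * ∏ i, f (z i)) - Real.log (Zπ⁻¹ * ∏ i, g (z i)) ≤
        (N + 1 : ℕ) * e + ((N + 1 : ℕ) * (e * (5 / 2 + θm⁻¹)) +
          e * (1 + θm⁻¹) / 2 * ∑ i, ‖(z i).2 - u₀ (z i).1‖ ^ 2) := by
      rw [hLψ, hLψπ]
      linarith
    have hkey' := mul_le_mul_of_nonneg_left hkey hp1.le
    rw [← Finset.mul_sum, hs]
    nlinarith [hkey', hQ0]
  -- assembling
  have hLG : localGibbsMeasure σ a u₀ θ₀ N = volume.withDensity fun z => ENNReal.ofReal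
      (canonicalDensity (Torus.geometry (Fin 3)) ε (N + 1) f z) := rfl
  rw [liouville_eq]
  calc ∫⁻ z in hardSphereDomain (Torus.geometry (Fin 3)) (N + 1) ε,
        ENNReal.ofReal (canonicalDensity (Torus.geometry (Fin 3)) ε (N + 1) f z) ^ p *
          ENNReal.ofReal (canonicalDensity (Torus.geometry (Fin 3)) ε (N + 1) g z) ^ (1 - p)
      ≤ ∫⁻ z in hardSphereDomain (Torus.geometry (Fin 3)) (N + 1) ε,
          ENNReal.ofReal (C₁ ^ (N + 1)) *
            (ENNReal.ofReal (canonicalDensity (Torus.geometry (Fin 3)) ε (N + 1) f z) *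
              ∏ i, G (z i)) := setLIntegral_mono' hDm hpt
    _ ≤ ∫⁻ z, ENNReal.ofReal (C₁ ^ (N + 1)) *
            (ENNReal.ofReal (canonicalDensity (Torus.geometry (Fin 3)) ε (N + 1) f z) *
              ∏ i, G (z i)) := setLIntegral_le_lintegral _ _
    _ = ENNReal.ofReal (C₁ ^ (N + 1)) * ∫⁻ z, ∏ i, G (z i) ∂(localGibbsMeasure σ a u₀ θ₀ N) := by
        rw [lintegral_const_mul' _ _ ENNReal.ofReal_ne_top, hLG,
          lintegral_withDensity_eq_lintegral_mul _ hψm hGpm]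
        rfl
    _ ≤ ENNReal.ofReal (C₁ ^ (N + 1)) * ENNReal.ofReal K ^ (N + 1) :=
        mul_le_mul_right (KineticCurrentsWindowLDUniformSketch.stub_fibreExpMoment a θ₀ u₀ ha hθ
          hu ha0 hθ0 σ hσ hσ2 N G hGm _ hfib) _
    _ ≤ ENNReal.ofReal (Real.exp (p * (δ * ((N : ℝ) + 1)))) := by
        rw [← ENNReal.ofReal_pow hK0, ← ENNReal.ofReal_mul (pow_nonneg hC₁0.le _), ← mul_pow]
        refine ENNReal.ofReal_le_ofReal ?_
        calc (C₁ * K) ^ (N + 1) ≤ Real.exp (p * δ) ^ (N + 1) :=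
              pow_le_pow_left₀ (mul_nonneg hC₁0.le hK0) hCK _
          _ = Real.exp (p * (δ * ((N : ℝ) + 1))) := by
              rw [← Real.exp_nat_mul]
              congr 1
              push_cast
              ring

end Summit.AtomisticToContinuum.HydrodynamicLimit.Theorems.KineticCurrentsWindowLDUniformSigmaUniform

end
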